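import Mathlib
import Literature.AlgebraicGeometry.Resolution.WeightedQuasiRegular
import HarnessLib

/-!
# The weighted-order law along a chain of point blowing ups following an axis

Topic: `Literature/AlgebraicGeometry/Resolution`. Completion-free form of the "standard arguments"
of the termination proof of Cossart–Piltant 2008, Prop. 4.4 (p. 11, case `τ = 2`): "there exists
a regular (possibly formal) curve `Γ` such that `x_{σ(i)}` belongs to the strict transform of `Γ`
for `i ≥ i₁`. By standard arguments, we must have `Γ ⊆ Σ(i₁)`". In local rings: let
`(R_n, 𝔪_n)` be regular local rings of dimension `3` with regular systems of parameters
`(u_n; y₂⁽ⁿ⁾, y₃⁽ⁿ⁾)` and local homomorphisms `φ_n : R_n → R_{n+1}` with `φ_n(u_n) = u_{n+1}`,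
`φ_n(y_i⁽ⁿ⁾) = u_{n+1} y_i⁽ⁿ⁺¹⁾` (not even assumed local; the origin of the `u`-chart of the blowing up of `𝔪_n`: the point
of the strict transform of the curve `Γ = V(y₂, y₃)`), and ideals `J_n ⊆ 𝔪_n^μ` ("all the points
are near") with `(J_n R_{n+1} : u^μ) ⊆ J_{n+1}` (weak transforms). THEN `J_0 ⊆ (y₂, y₃)^μ`, i.e.
`J_0` has order `μ` along `Γ` (`le_pow_span_of_nearChain`). Ingredients:

* `map_weightedIdeal_le` — `φ(F^{(e+1)}_ρ) ⊆ F'^{(e)}_ρ` (monomials go to monomials of the same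
  weight);
* `mem_weightedIdeal_of_map_mem` — **contraction** `F'^{(e)}_ρ ∩ R = F^{(e+1)}_ρ`, from weighted
  quasi-regularity of `R'` (`WeightedQuasiRegular.lean`) applied to the weight-`σ` part of a
  representative of `f` with a unit coefficient;
* `le_weightedIdeal_of_weakTransform_le` — **the law** `(JR' : u^μ) ⊆ F'^{(e)}_{eμ} ⇒ J ⊆ F^{(e+1)}_{(e+1)μ}`;
* `le_weightedIdeal_of_nearChain`, `le_pow_span_sup_of_nearChain` — iteration along a FINITE
  chain of length `N`: `J_0 ⊆ F^{(N+1)}_{(N+1)μ} ⊆ (y₂, y₃)^μ + (u^{N+1})`;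
* `le_pow_span_of_nearChain` — along an infinite chain `J_0 ⊆ ⋂_d F^{(d)}_{dμ} ⊆ (y₂, y₃)^μ`
  (`WeightedOrderIdeals.lean`).

## Sources

* V. Cossart, O. Piltant, J. Algebra 320 (2008), proof of Prop. 4.4, p. 11. [CossartPiltant2008]
* H. Hironaka, *Characteristic polyhedra of singularities*, J. Math. Kyoto Univ. 7 (1967). [Hironaka1967]
-/

noncomputable section

open IsLocalRing MvPolynomial

namespace Literature.AlgebraicGeometry.Resolution

universe u

section Chart

variable {R R' : Type u} [CommRing R] [CommRing R'] (φ : R →+* R') {u y₂ y₃ : R}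
  {u' y₂' y₃' : R'} (hu : φ u = u') (hy₂ : φ y₂ = u' * y₂') (hy₃ : φ y₃ = u' * y₃') (e : ℕ)

include hu hy₂ hy₃ in
/-- The image of a monomial: `φ(uᵏ y₂ᵃ y₃ᵇ) = u'^{k+a+b} y₂'ᵃ y₃'ᵇ`. [folklore] -/
theorem map_monomial_chart (k a b : ℕ) :
    φ (u ^ k * y₂ ^ a * y₃ ^ b) = u' ^ (k + a + b) * y₂' ^ a * y₃' ^ b := by
  rw [map_mul, map_mul, map_pow, map_pow, map_pow, hu, hy₂, hy₃]; ring

include hu hy₂ hy₃ in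
/-- **`φ(F^{(e+1)}_ρ) ⊆ F'^{(e)}_ρ`.** [cite: Hironaka1967, §1] -/
theorem map_weightedIdeal_le (ρ : ℕ) :
    (weightedIdeal u y₂ y₃ (e + 1) ρ).map φ ≤ weightedIdeal u' y₂' y₃' e ρ := by
  rw [weightedIdeal, Ideal.map_span]
  refine Ideal.span_le.mpr ?_
  rintro _ ⟨_, ⟨k, a, b, hk, rfl⟩, rfl⟩
  rw [map_monomial_chart φ hu hy₂ hy₃]
  refine monomial_mem_weightedIdeal u' y₂' y₃' ?_
  nlinarith

variable [IsRegularLocalRing R] [IsRegularLocalRing R']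
  (hgen : Ideal.span {u, y₂, y₃} = maximalIdeal R) (hdim : ringKrullDim R = 3)
  (hgen' : Ideal.span {u', y₂', y₃'} = maximalIdeal R') (hdim' : ringKrullDim R' = 3) (he : 0 < e)

/-- The exponent map `(k, a, b) ↦ (k + a + b, a, b)` of the chart. [folklore] -/
def chartExp (m : Fin 3 →₀ ℕ) : Fin 3 →₀ ℕ :=
  Finsupp.equivFunOnFinite.symm ![m 0 + m 1 + m 2, m 1, m 2]

/-- Simp lemma / component formula. [folklore] -/
@[simp] theorem chartExp_apply_zero (m : Fin 3 →₀ ℕ) : chartExp m 0 = m 0 + m 1 + m 2 := rfl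
/-- Simp lemma / component formula. [folklore] -/
@[simp] theorem chartExp_apply_one (m : Fin 3 →₀ ℕ) : chartExp m 1 = m 1 := rfl
/-- Simp lemma / component formula. [folklore] -/
@[simp] theorem chartExp_apply_two (m : Fin 3 →₀ ℕ) : chartExp m 2 = m 2 := rfl

/-- `chartExp` is injective. [folklore] -/
theorem chartExp_injective : Function.Injective chartExp := by
  intro m m' h
  have h1 := congrArg (fun n : Fin 3 →₀ ℕ => n 1) h
  have h2 := congrArg (fun n : Fin 3 →₀ ℕ => n 2) h
  have h0 := congrArg (fun n : Fin 3 →₀ ℕ => n 0) h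
  simp only [chartExp_apply_zero, chartExp_apply_one, chartExp_apply_two] at h0 h1 h2
  ext i
  fin_cases i
  · simp only [Fin.zero_eta]; omega
  · exact h1
  · exact h2

/-- `chartExp` turns weight `(1, e+1, e+1)` into weight `(1, e, e)`. [folklore] -/
theorem weight_chartExp (m : Fin 3 →₀ ℕ) :
    Finsupp.weight (wt e) (chartExp m) = Finsupp.weight (wt (e + 1)) m := by
  rw [weight_wt_eq, weight_wt_eq]
  simp only [chartExp_apply_zero, chartExp_apply_one, chartExp_apply_two]
  ring

include hu hy₂ hy₃ hgen hgen' hdim' he in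
/-- **Contraction** `F'^{(e)}_ρ ∩ R ⊆ F^{(e+1)}_ρ`: an element of `R` whose image lies in the
weighted ideal of the chart already lies in the weighted ideal of `R` (weighted quasi-regularity
of `R'` applied to the weight-`σ` part of a representative with a unit coefficient).
[cite: Hironaka1967, §1] [cite: CossartPiltant2008, proof of Prop. 4.4, p. 11] -/
theorem mem_weightedIdeal_of_map_mem {ρ : ℕ} {f : R}
    (hf : φ f ∈ weightedIdeal u' y₂' y₃' e ρ) : f ∈ weightedIdeal u y₂ y₃ (e + 1) ρ := by
  classical
  -- by induction on `σ ≤ ρ`: `f ∈ F_σ`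
  suffices key : ∀ σ, σ ≤ ρ → f ∈ weightedIdeal u y₂ y₃ (e + 1) σ from key ρ le_rfl
  intro σ
  induction σ with
  | zero =>
    intro _
    have h1 : (1 : R) ∈ weightedIdeal u y₂ y₃ (e + 1) 0 := by
      simpa using monomial_mem_weightedIdeal u y₂ y₃ (d := e + 1) (ρ := 0) (k := 0) (a := 0)
        (b := 0) le_rfl
    simpa using Ideal.mul_mem_left _ f h1
  | succ σ ih =>
    intro hσρ
    have hfσ := ih (by omega)
    -- a representative `P` of `f` with monomials of weight `≥ σ`, split at weight `σ`
    obtain ⟨P, hP, hPf⟩ := (mem_weightedIdeal_iff_exists_mvPolynomial u y₂ y₃ (e + 1) σ f).mp hfσ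
    set Pσ := weightedHomogeneousComponent (wt (e + 1)) σ P with hPσ
    have hPσhom : Pσ.IsWeightedHomogeneous (wt (e + 1)) σ :=
      weightedHomogeneousComponent_isWeightedHomogeneous σ P
    have hrest : eval ![u, y₂, y₃] (P - Pσ) ∈ weightedIdeal u y₂ y₃ (e + 1) (σ + 1) := by
      refine (mem_weightedIdeal_iff_exists_mvPolynomial u y₂ y₃ (e + 1) (σ + 1) _).mpr
        ⟨P - Pσ, fun m hm => ?_, rfl⟩
      rw [mem_support_iff, coeff_sub, hPσ, coeff_weightedHomogeneousComponent] at hm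
      by_cases hwt : Finsupp.weight (wt (e + 1)) m = σ
      · rw [if_pos hwt, sub_self] at hm; exact absurd rfl hm
      · rw [if_neg hwt, sub_zero] at hm
        have := hP m (mem_support_iff.mpr hm)
        omega
    -- the transported weight-`σ` part `Pσ'` over `R'`
    set Q : MvPolynomial (Fin 3) R' :=
      ∑ n ∈ Pσ.support, monomial (chartExp n) (φ (Pσ.coeff n)) with hQ
    have hQcoeff : ∀ n ∈ Pσ.support, Q.coeff (chartExp n) = φ (Pσ.coeff n) := by
      intro n hn
      rw [hQ, coeff_sum, Finset.sum_eq_single n]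
      · rw [coeff_monomial, if_pos rfl]
      · intro n' _ hne
        rw [coeff_monomial, if_neg]
        exact fun h' => hne (chartExp_injective h')
      · intro hn'; exact absurd hn hn'
    have hQsupp : ∀ m ∈ Q.support, Finsupp.weight (wt e) m = σ := by
      intro m hm
      rw [hQ] at hm
      obtain ⟨n, hn, hmn⟩ := Finset.mem_biUnion.mp (support_sum hm)
      have hmn' := Finset.mem_singleton.mp (support_monomial_subset hmn)
      subst hmn'
      rw [weight_chartExp]
      exact hPσhom (mem_support_iff.mp hn)
    have hQeval : eval ![u', y₂', y₃'] Q = φ (eval ![u, y₂, y₃] Pσ) := by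
      conv_rhs => rw [Pσ.as_sum, map_sum, map_sum]
      rw [hQ, map_sum]
      refine Finset.sum_congr rfl fun n _ => ?_
      rw [eval_monomial_three, eval_monomial_three, map_mul]
      congr 1
      simp only [Matrix.cons_val_zero, Matrix.cons_val_one, Matrix.cons_val_two, Matrix.tail_cons,
        Matrix.head_cons, chartExp_apply_zero, chartExp_apply_one, chartExp_apply_two]
      rw [map_monomial_chart φ hu hy₂ hy₃]
    -- `Q(u', y') ∈ F'_{σ+1}`
    have hQmem : eval ![u', y₂', y₃'] Q ∈ weightedIdeal u' y₂' y₃' e (σ + 1) := by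
      rw [hQeval]
      have h1 : φ f ∈ weightedIdeal u' y₂' y₃' e (σ + 1) := weightedIdeal_antitone _ _ _ e hσρ hf
      have h2 : φ (eval ![u, y₂, y₃] (P - Pσ)) ∈ weightedIdeal u' y₂' y₃' e (σ + 1) :=
        map_weightedIdeal_le φ hu hy₂ hy₃ e (σ + 1) (Ideal.mem_map_of_mem _ hrest)
      have : eval ![u, y₂, y₃] Pσ = f - eval ![u, y₂, y₃] (P - Pσ) := by
        rw [map_sub, hPf]; ring
      rw [this, map_sub]
      exact Ideal.sub_mem _ h1 h2
    -- weighted quasi-regularity in `R'`: the coefficients of `Pσ` lie in `𝔪`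
    have hcoeff : ∀ n, Pσ.coeff n ∈ maximalIdeal R := by
      intro n
      by_cases hn : n ∈ Pσ.support
      swap
      · rw [notMem_support_iff.mp hn]; exact Ideal.zero_mem _
      have hc := coeff_mem_maximalIdeal_of_weval_mem u' y₂' y₃' hgen' hdim' he hQsupp hQmem
        (chartExp n)
      rw [hQcoeff n hn] at hc
      by_contra hcm
      have hunit : IsUnit (Pσ.coeff n) := by
        by_contra h'; exact hcm ((IsLocalRing.mem_maximalIdeal _).mpr h')
      exact (IsLocalRing.mem_maximalIdeal _).mp hc (hunit.map φ)
    -- hence `Pσ(u, y) ∈ 𝔪 · F_σ ⊆ F_{σ+1}` and `f ∈ F_{σ+1}`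
    have hPσmem : eval ![u, y₂, y₃] Pσ ∈ weightedIdeal u y₂ y₃ (e + 1) (σ + 1) := by
      rw [Pσ.as_sum, map_sum]
      refine Ideal.sum_mem _ fun n hn => ?_
      rw [eval_monomial_three, add_comm σ 1]
      refine weightedIdeal_mul_le u y₂ y₃ (e + 1) 1 σ (Ideal.mul_mem_mul ?_ ?_)
      · exact pow_span_le_weightedIdeal u y₂ y₃ (d := e + 1) (by omega) 1
          (by rw [pow_one, hgen]; exact hcoeff n)
      · refine monomial_mem_weightedIdeal u y₂ y₃ ?_
        have := hPσhom (mem_support_iff.mp hn)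
        rw [weight_wt_eq] at this
        simpa using this.ge
    have : f = eval ![u, y₂, y₃] Pσ + eval ![u, y₂, y₃] (P - Pσ) := by
      rw [map_sub, hPf]; ring
    rw [this]
    exact Ideal.add_mem _ hPσmem hrest

include hu hy₂ hy₃ hgen hgen' hdim' he in
/-- **The weighted-order law under the blowing up** (Hironaka; the expansion-free form): if
`J ⊆ 𝔪^μ` and the weak transform `(JR' : u'^μ)` lies in `F'^{(e)}_{eμ}`, then `J ⊆ F^{(e+1)}_{(e+1)μ}`.
[cite: Hironaka1967, §1] [cite: CossartPiltant2008, proof of Prop. 4.4, p. 11] -/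
theorem le_weightedIdeal_of_weakTransform_le {J : Ideal R} {μ : ℕ}
    (hJμ : J ≤ maximalIdeal R ^ μ)
    (hJ' : ∀ g : R', u' ^ μ * g ∈ J.map φ → g ∈ weightedIdeal u' y₂' y₃' e (e * μ)) :
    J ≤ weightedIdeal u y₂ y₃ (e + 1) ((e + 1) * μ) := by
  intro f hf
  refine mem_weightedIdeal_of_map_mem φ hu hy₂ hy₃ e hgen hgen' hdim' he ?_
  -- `φ(𝔪^μ) ⊆ (u'^μ)`, so `φ f = u'^μ g`
  have hφm : (maximalIdeal R).map φ ≤ Ideal.span {u'} := by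
    rw [← hgen, Ideal.map_span, Ideal.span_le]
    rintro _ ⟨a, ha, rfl⟩
    simp only [Set.mem_insert_iff, Set.mem_singleton_iff] at ha
    rcases ha with rfl | rfl | rfl
    · rw [hu]; exact Ideal.subset_span rfl
    · rw [hy₂]; exact Ideal.mul_mem_right _ _ (Ideal.subset_span rfl)
    · rw [hy₃]; exact Ideal.mul_mem_right _ _ (Ideal.subset_span rfl)
  have hφf : φ f ∈ Ideal.span {u' ^ μ} := by
    rw [← Ideal.span_singleton_pow]
    have : φ f ∈ (maximalIdeal R ^ μ).map φ := Ideal.mem_map_of_mem _ (hJμ hf)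
    rw [Ideal.map_pow] at this
    exact Ideal.pow_right_mono hφm μ this
  obtain ⟨g, hg⟩ := Ideal.mem_span_singleton'.mp hφf
  rw [mul_comm] at hg
  have hg' : g ∈ weightedIdeal u' y₂' y₃' e (e * μ) :=
    hJ' g (hg ▸ Ideal.mem_map_of_mem _ hf)
  rw [← hg, show (e + 1) * μ = μ + e * μ by ring]
  refine weightedIdeal_mul_le u' y₂' y₃' e μ (e * μ) (Ideal.mul_mem_mul ?_ hg')
  simpa using monomial_mem_weightedIdeal u' y₂' y₃' (d := e) (ρ := μ) (k := μ) (a := 0) (b := 0)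
    (by omega)

end Chart

/-! ## Along a chain -/

section Chain

variable {Rn : ℕ → Type u} [∀ n, CommRing (Rn n)] [∀ n, IsRegularLocalRing (Rn n)]
  (φ : ∀ n, Rn n →+* Rn (n + 1)) (u y₂ y₃ : ∀ n, Rn n) (N : ℕ)
  (hgen : ∀ n, n ≤ N → Ideal.span {u n, y₂ n, y₃ n} = maximalIdeal (Rn n))
  (hdim : ∀ n, ringKrullDim (Rn n) = 3) (J : ∀ n, Ideal (Rn n)) {μ : ℕ}
  (hu : ∀ n, n + 1 ≤ N → φ n (u n) = u (n + 1))
  (hy₂ : ∀ n, n + 1 ≤ N → φ n (y₂ n) = u (n + 1) * y₂ (n + 1))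
  (hy₃ : ∀ n, n + 1 ≤ N → φ n (y₃ n) = u (n + 1) * y₃ (n + 1))
  (hJμ : ∀ n, n ≤ N → J n ≤ maximalIdeal (Rn n) ^ μ)
  (hJ : ∀ n, n + 1 ≤ N → ∀ g : Rn (n + 1), u (n + 1) ^ μ * g ∈ (J n).map (φ n) → g ∈ J (n + 1))

include hgen hdim hu hy₂ hy₃ hJμ hJ in
/-- **Along a chain of `N` point blowing ups following the axis `V(y₂, y₃)` through near points,
`J_n ⊆ F^{(d+1)}_{(d+1)μ}` whenever `n + d ≤ N`.** [cite: CossartPiltant2008, proof of Prop. 4.4, p. 11] -/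
theorem le_weightedIdeal_of_nearChain {d n : ℕ} (hdn : d + n ≤ N) :
    J n ≤ weightedIdeal (u n) (y₂ n) (y₃ n) (d + 1) ((d + 1) * μ) := by
  induction d generalizing n with
  | zero =>
    rw [zero_add, one_mul]
    refine (hJμ n (by omega)).trans ?_
    rw [← hgen n (by omega)]
    exact pow_span_le_weightedIdeal (u n) (y₂ n) (y₃ n) le_rfl μ
  | succ d ih =>
    refine le_weightedIdeal_of_weakTransform_le (φ n) (hu n (by omega)) (hy₂ n (by omega))
      (hy₃ n (by omega)) (d + 1) (hgen n (by omega)) (hgen (n + 1) (by omega)) (hdim (n + 1))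
      (by omega) (hJμ n (by omega)) fun g hg => ?_
    exact ih (n := n + 1) (by omega) (hJ n (by omega) g hg)

include hgen hdim hu hy₂ hy₃ hJμ hJ in
/-- In particular **`J_0 ⊆ F^{(N+1)}_{(N+1)μ} ⊆ (y₂, y₃)^μ + (u^{N+1})`** at the bottom of a chain of
length `N`. [cite: CossartPiltant2008, proof of Prop. 4.4, p. 11] -/
theorem le_pow_span_sup_of_nearChain :
    J 0 ≤ Ideal.span {y₂ 0, y₃ 0} ^ μ ⊔ Ideal.span {u 0 ^ (N + 1)} :=
  (le_weightedIdeal_of_nearChain φ u y₂ y₃ N hgen hdim J hu hy₂ hy₃ hJμ hJ (d := N) (n := 0)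
    le_rfl).trans (weightedIdeal_le_sup (u 0) (y₂ 0) (y₃ 0) (N + 1) μ)

end Chain

section InfiniteChain

variable {Rn : ℕ → Type u} [∀ n, CommRing (Rn n)] [∀ n, IsRegularLocalRing (Rn n)]
  (φ : ∀ n, Rn n →+* Rn (n + 1)) (u y₂ y₃ : ∀ n, Rn n)
  (hgen : ∀ n, Ideal.span {u n, y₂ n, y₃ n} = maximalIdeal (Rn n))
  (hdim : ∀ n, ringKrullDim (Rn n) = 3) (hu : ∀ n, φ n (u n) = u (n + 1))
  (hy₂ : ∀ n, φ n (y₂ n) = u (n + 1) * y₂ (n + 1))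
  (hy₃ : ∀ n, φ n (y₃ n) = u (n + 1) * y₃ (n + 1)) (J : ∀ n, Ideal (Rn n)) {μ : ℕ}
  (hJμ : ∀ n, J n ≤ maximalIdeal (Rn n) ^ μ)
  (hJ : ∀ n (g : Rn (n + 1)), u (n + 1) ^ μ * g ∈ (J n).map (φ n) → g ∈ J (n + 1))

include hgen hdim hu hy₂ hy₃ hJμ hJ in
/-- **`J_0 ⊆ (y₂, y₃)^μ`** along an infinite chain of near points following the strict transforms
of the regular curve `Γ = V(y₂, y₃)`: the ideal has order `μ` along `Γ`, i.e. `Γ ⊆ Σ`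
(Cossart–Piltant's "standard arguments"). [cite: CossartPiltant2008, proof of Prop. 4.4, p. 11] -/
theorem le_pow_span_of_nearChain : J 0 ≤ Ideal.span {y₂ 0, y₃ 0} ^ μ := by
  have hu0 : u 0 ∈ maximalIdeal (Rn 0) := (hgen 0) ▸ Ideal.subset_span (by simp)
  refine le_trans ?_ (iInf_weightedIdeal_le (u 0) (y₂ 0) (y₃ 0) hu0 μ)
  exact le_iInf fun d => le_weightedIdeal_of_nearChain φ u y₂ y₃ d (fun n _ => hgen n) hdim J
    (fun n _ => hu n) (fun n _ => hy₂ n) (fun n _ => hy₃ n) (fun n _ => hJμ n) (fun n _ => hJ n)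
    (d := d) (n := 0) le_rfl

end InfiniteChain



end Literature.AlgebraicGeometry.Resolution

end
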